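import Mathlib

/-!
# The branch-counting lemma behind the Burton–Keane trifurcation bound (abstract form)

Cell pub-perc-repro0, seat p6. Kernel-checked companion of `proofs/UNIQUENESS-p6-v1.md`, Lemma 3.5
(the abstract counting lemma `|Y| ≥ |R| + 2`), stated in a purely set-theoretic form that isolates
exactly the properties of "the connected components of `K − v`" that the paper proof uses:

* a *branch system*: for every `v ∈ R` the family `B v` of *branches at `v`* consists of
  pairwise disjoint subsets of `Vs \ {v}` covering `Vs \ {v}` (in the application: the components
  of `K − v`, `Vs` the vertex set of the cluster `K`), and the families are *nested*: if `v' ∈ R`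
  lies in the branch `W'` at `v`, then every branch at `v'` not containing `v` is contained in `W'`
  (in the application: such a branch together with `v'` is connected and avoids `v`);
* three distinct branches at every `v ∈ R` meet `Y` (in the application: `v` is a trifurcation
  of the infinite cluster `K` and `Y = K ∩ ∂Λ_{n+1}`).
(No auxiliary definition is introduced: the hypotheses are spelled out in the theorem, so that
the gate treats the file as a pure proof.)

`card_add_two_le` states `|R| + 2 ≤ |Y|` whenever `R ⊆ Vs`, `Y ⊆ Vs`, `R ∩ Y = ∅` and `R ≠ ∅`.
The proof is the induction of the paper: choose an admissible pair `(v, W)` — a branch `W` at `v`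
meeting `Y` — with `|W ∩ R|` minimal; then `W ∩ R = ∅` (Claim 1), and deleting `W` and `v` gives a
smaller instance (Claims 2–3), on the same ambient type `V` with the ambient set `Vs \ W`.
No percolation object appears here; the translation from graphs is the "Structure" paragraph of
Definition 3.0 and the first paragraph of Lemma 3.6 in the paper file.
-/

namespace Summit.Ventures.PercRepro0.BranchCount

open Finset

variable {V : Type*}

/-- Among three pairwise disjoint, pairwise distinct sets, one of them is different from a given
set `W` and does not contain a given point `u`. -/
theorem exists_ne_and_not_mem {W₁ W₂ W₃ W : Set V} {u : V}
    (h₁₂ : W₁ ≠ W₂) (h₁₃ : W₁ ≠ W₃) (h₂₃ : W₂ ≠ W₃)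
    (d₁₂ : Disjoint W₁ W₂) (d₁₃ : Disjoint W₁ W₃) (d₂₃ : Disjoint W₂ W₃) :
    (W₁ ≠ W ∧ u ∉ W₁) ∨ (W₂ ≠ W ∧ u ∉ W₂) ∨ (W₃ ≠ W ∧ u ∉ W₃) := by
  by_cases e1 : W₁ ≠ W ∧ u ∉ W₁
  · exact Or.inl e1
  by_cases e2 : W₂ ≠ W ∧ u ∉ W₂
  · exact Or.inr (Or.inl e2)
  have f1 : W₁ = W ∨ u ∈ W₁ := by
    by_cases h : W₁ = W
    · exact Or.inl h
    · exact Or.inr (Classical.byContradiction fun hu => e1 ⟨h, hu⟩)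
  have f2 : W₂ = W ∨ u ∈ W₂ := by
    by_cases h : W₂ = W
    · exact Or.inl h
    · exact Or.inr (Classical.byContradiction fun hu => e2 ⟨h, hu⟩)
  refine Or.inr (Or.inr ⟨?_, ?_⟩)
  · intro e3
    have hu1 : u ∈ W₁ := f1.resolve_left (fun e => h₁₃ (e.trans e3.symm))
    have hu2 : u ∈ W₂ := f2.resolve_left (fun e => h₂₃ (e.trans e3.symm))
    exact Set.disjoint_left.mp d₁₂ hu1 hu2
  · intro hu3
    have e1' : W₁ = W := f1.resolve_right (fun hu1 => Set.disjoint_left.mp d₁₃ hu1 hu3)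
    have e2' : W₂ = W := f2.resolve_right (fun hu2 => Set.disjoint_left.mp d₂₃ hu2 hu3)
    exact h₁₂ (e1'.trans e2'.symm)

/-- The counting lemma (UNIQUENESS-p6-v1, Lemma 3.5, abstract form). Hypotheses, for the cut
vertices `v ∈ R` on the ambient vertex set `Vs` with branch families `B v` (in the application:
the connected components of `K − v`): `hsubset` every branch at `v` lies in `Vs \ {v}`; `hdisj`
distinct branches at `v` are disjoint; `hcover` the branches at `v` cover `Vs \ {v}`; `hnest`
a branch at `v'` not containing `v` lies inside the branch at `v` containing `v'`; `h3` every
`v ∈ R` has three distinct branches meeting `Y`. Conclusion: `|R| + 2 ≤ |Y|`. -/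
theorem card_add_two_le :
    ∀ (n : ℕ) (Vs : Set V) (R Y : Finset V) (B : V → Set (Set V)),
      R.card = n → R.Nonempty → (R : Set V) ⊆ Vs → (Y : Set V) ⊆ Vs → Disjoint R Y →
      (∀ v ∈ R, ∀ W ∈ B v, W ⊆ Vs \ {v}) →
      (∀ v ∈ R, ∀ W ∈ B v, ∀ W' ∈ B v, W ≠ W' → Disjoint W W') →
      (∀ v ∈ R, ∀ u ∈ Vs \ {v}, ∃ W ∈ B v, u ∈ W) →
      (∀ v ∈ R, ∀ v' ∈ R, v ≠ v' → ∀ W' ∈ B v, v' ∈ W' → ∀ W'' ∈ B v', v ∉ W'' → W'' ⊆ W') →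
      (∀ v ∈ R, ∃ W₁ ∈ B v, ∃ W₂ ∈ B v, ∃ W₃ ∈ B v, W₁ ≠ W₂ ∧ W₁ ≠ W₃ ∧ W₂ ≠ W₃ ∧
        (W₁ ∩ (Y : Set V)).Nonempty ∧ (W₂ ∩ (Y : Set V)).Nonempty ∧
        (W₃ ∩ (Y : Set V)).Nonempty) →
      R.card + 2 ≤ Y.card := by
  intro n
  induction n using Nat.strong_induction_on with
  | _ n ih =>
  intro Vs R Y B hcard hne hR hY hRY hsubset hdisj hcover hnest h3
  classical
  -- Step A: an admissible pair `(v, W)` with `|W ∩ R|` minimal.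
  have hex : ∃ m : ℕ, ∃ v ∈ R, ∃ W ∈ B v, (W ∩ (Y : Set V)).Nonempty ∧
      (R.filter (fun x => x ∈ W)).card = m := by
    obtain ⟨v, hv⟩ := hne
    obtain ⟨W₁, hW₁, _, _, _, _, _, _, _, hW₁Y, _, _⟩ := h3 v hv
    exact ⟨_, v, hv, W₁, hW₁, hW₁Y, rfl⟩
  obtain ⟨v, hv, W, hW, hWY, hWm⟩ := Nat.find_spec hex
  have hmin : ∀ v' ∈ R, ∀ W' ∈ B v', (W' ∩ (Y : Set V)).Nonempty →
      (R.filter (fun x => x ∈ W)).card ≤ (R.filter (fun x => x ∈ W')).card := by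
    intro v' hv' W' hW' hW'Y
    rw [hWm]
    exact Nat.find_min' hex ⟨v', hv', W', hW', hW'Y, rfl⟩
  have hvW : v ∉ W := fun h => ((hsubset v hv W hW) h).2 rfl
  -- Claim 1: `W ∩ R = ∅`.
  have claim1 : ∀ v' ∈ R, v' ∉ W := by
    intro v' hv' hv'W
    have hvv' : v ≠ v' := fun e => hvW (e ▸ hv'W)
    obtain ⟨W₁, hW₁, W₂, hW₂, W₃, hW₃, h₁₂, h₁₃, h₂₃, hW₁Y, hW₂Y, hW₃Y⟩ := h3 v' hv'
    have d₁₂ := hdisj v' hv' W₁ hW₁ W₂ hW₂ h₁₂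
    have d₁₃ := hdisj v' hv' W₁ hW₁ W₃ hW₃ h₁₃
    have d₂₃ := hdisj v' hv' W₂ hW₂ W₃ hW₃ h₂₃
    -- one of the three branches at `v'` does not contain `v`
    have key : ∀ Wa ∈ B v', (Wa ∩ (Y : Set V)).Nonempty → v ∉ Wa → False := by
      intro Wa hWa hWaY hvWa
      have hsub : Wa ⊆ W := hnest v hv v' hv' hvv' W hW hv'W Wa hWa hvWa
      have hv'Wa : v' ∉ Wa := fun h => ((hsubset v' hv' Wa hWa) h).2 rfl
      have hss : R.filter (fun x => x ∈ Wa) ⊂ R.filter (fun x => x ∈ W) := by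
        refine Finset.ssubset_iff_subset_ne.mpr ⟨?_, ?_⟩
        · intro x hx
          rw [Finset.mem_filter] at hx ⊢
          exact ⟨hx.1, hsub hx.2⟩
        · intro e
          have : v' ∈ R.filter (fun x => x ∈ Wa) := by
            rw [e, Finset.mem_filter]; exact ⟨hv', hv'W⟩
          rw [Finset.mem_filter] at this
          exact hv'Wa this.2
      exact absurd (hmin v' hv' Wa hWa hWaY) (not_le.mpr (Finset.card_lt_card hss))
    rcases exists_ne_and_not_mem (W := W) (u := v) h₁₂ h₁₃ h₂₃ d₁₂ d₁₃ d₂₃ with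
      ⟨_, h⟩ | ⟨_, h⟩ | ⟨_, h⟩
    · exact key W₁ hW₁ hW₁Y h
    · exact key W₂ hW₂ hW₂Y h
    · exact key W₃ hW₃ hW₃Y h
  -- Step B: the reduced instance.
  set R' := R.erase v with hR'def
  set Y' := Y.filter (fun y => y ∉ W) with hY'def
  have hY'lt : Y'.card < Y.card := by
    obtain ⟨y, hyW, hyY⟩ := hWY
    exact Finset.card_lt_card (Finset.filter_ssubset.mpr ⟨y, hyY, not_not.mpr hyW⟩)
  by_cases hR'ne : R'.Nonempty
  · -- inductive case
    set Vs' := Vs \ W with hVs'def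
    set B' : V → Set (Set V) := fun u => (fun X => X \ W) '' (B u) with hB'def
    have hmemR' : ∀ u ∈ R', u ∈ R ∧ u ≠ v := fun u hu =>
      ⟨Finset.mem_of_mem_erase hu, Finset.ne_of_mem_erase hu⟩
    have hR'card : R'.card < n := by
      rw [← hcard]; exact Finset.card_erase_lt_of_mem hv
    have hR' : (R' : Set V) ⊆ Vs' := by
      intro x hx
      have hx' := hmemR' x hx
      exact ⟨hR hx'.1, claim1 x hx'.1⟩
    have hY' : (Y' : Set V) ⊆ Vs' := by
      intro y hy
      have hy' := Finset.mem_filter.mp hy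
      exact ⟨hY hy'.1, hy'.2⟩
    have hRY' : Disjoint R' Y' :=
      hRY.mono (Finset.erase_subset _ _) (Finset.filter_subset _ _)
    have hsubset' : ∀ u ∈ R', ∀ X ∈ B' u, X ⊆ Vs' \ {u} := by
      intro u hu X hX
      obtain ⟨X₀, hX₀, rfl⟩ := hX
      intro x hx
      have h := hsubset u (hmemR' u hu).1 X₀ hX₀ hx.1
      exact ⟨⟨h.1, hx.2⟩, h.2⟩
    have hdisj' : ∀ u ∈ R', ∀ X ∈ B' u, ∀ X' ∈ B' u, X ≠ X' → Disjoint X X' := by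
      intro u hu X hX X' hX' hXX'
      obtain ⟨X₀, hX₀, rfl⟩ := hX
      obtain ⟨X₁, hX₁, rfl⟩ := hX'
      have hne01 : X₀ ≠ X₁ := fun e => hXX' (by rw [e])
      exact (hdisj u (hmemR' u hu).1 X₀ hX₀ X₁ hX₁ hne01).mono
        Set.sdiff_subset Set.sdiff_subset
    have hcover' : ∀ u ∈ R', ∀ x ∈ Vs' \ {u}, ∃ X ∈ B' u, x ∈ X := by
      intro u hu x hx
      obtain ⟨X₀, hX₀, hxX₀⟩ := hcover u (hmemR' u hu).1 x ⟨hx.1.1, hx.2⟩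
      exact ⟨X₀ \ W, ⟨X₀, hX₀, rfl⟩, hxX₀, hx.1.2⟩
    have hnest' : ∀ u ∈ R', ∀ u' ∈ R', u ≠ u' → ∀ X' ∈ B' u, u' ∈ X' →
        ∀ Z' ∈ B' u', u ∉ Z' → Z' ⊆ X' := by
      intro u hu u' hu' huu' X' hX' hu'X' Z' hZ' huZ'
      obtain ⟨X₀, hX₀, rfl⟩ := hX'
      obtain ⟨Z₀, hZ₀, rfl⟩ := hZ'
      have huW : u ∉ W := claim1 u (hmemR' u hu).1
      have huZ₀ : u ∉ Z₀ := fun h => huZ' ⟨h, huW⟩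
      have hsub := hnest u (hmemR' u hu).1 u' (hmemR' u' hu').1 huu' X₀ hX₀ hu'X'.1 Z₀ hZ₀ huZ₀
      exact Set.sdiff_subset_sdiff_left hsub
    have h3' : ∀ u ∈ R', ∃ W₁ ∈ B' u, ∃ W₂ ∈ B' u, ∃ W₃ ∈ B' u, W₁ ≠ W₂ ∧ W₁ ≠ W₃ ∧ W₂ ≠ W₃ ∧
        (W₁ ∩ (Y' : Set V)).Nonempty ∧ (W₂ ∩ (Y' : Set V)).Nonempty ∧
        (W₃ ∩ (Y' : Set V)).Nonempty := by
      intro u hu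
      have huR := (hmemR' u hu).1
      have huv : u ≠ v := (hmemR' u hu).2
      have huW : u ∉ W := claim1 u huR
      -- the branch `U` at `u` containing `v`, and `W ⊆ U`
      obtain ⟨U, hU, hvU⟩ := hcover u huR v ⟨hR hv, fun e => huv (Set.mem_singleton_iff.mp e).symm⟩
      have hWU : W ⊆ U := hnest u huR v hv huv U hU hvU W hW huW
      -- branches at `u` other than `U` miss `W`
      have hmiss : ∀ X₀ ∈ B u, X₀ ≠ U → Disjoint X₀ W := fun X₀ hX₀ hne =>
        (hdisj u huR X₀ hX₀ U hU hne).mono_right hWU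
      -- injectivity of `X ↦ X \ W` on the branches at `u`
      have hinj : ∀ X₀ ∈ B u, ∀ X₁ ∈ B u, X₀ \ W = X₁ \ W → X₀ = X₁ := by
        intro X₀ hX₀ X₁ hX₁ he
        by_contra hne
        by_cases h0 : X₀ = U
        · subst h0
          have h1 : X₁ ≠ X₀ := fun e => hne e.symm
          have hvX₁ : v ∈ X₁ := by
            have : v ∈ X₀ \ W := ⟨hvU, hvW⟩
            rw [he] at this
            exact this.1
          exact Set.disjoint_left.mp (hdisj u huR X₁ hX₁ X₀ hX₀ h1) hvX₁ hvU
        · by_cases h1 : X₁ = U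
          · subst h1
            have hvX₀ : v ∈ X₀ := by
              have : v ∈ X₁ \ W := ⟨hvU, hvW⟩
              rw [← he] at this
              exact this.1
            exact Set.disjoint_left.mp (hdisj u huR X₀ hX₀ X₁ hX₁ hne) hvX₀ hvU
          · have e0 : X₀ \ W = X₀ := sdiff_eq_left.mpr (hmiss X₀ hX₀ h0)
            have e1 : X₁ \ W = X₁ := sdiff_eq_left.mpr (hmiss X₁ hX₁ h1)
            exact hne (by rw [← e0, ← e1, he])
      -- every branch at `u` meeting `Y` still meets `Y'` after removing `W`
      have hmeet : ∀ X₀ ∈ B u, (X₀ ∩ (Y : Set V)).Nonempty →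
          ((X₀ \ W) ∩ (Y' : Set V)).Nonempty := by
        intro X₀ hX₀ hX₀Y
        by_cases h0 : X₀ = U
        · subst h0
          -- a branch `W₂ ≠ W` at `v` meeting `Y` and avoiding `u`
          obtain ⟨W₁', hW₁', W₂', hW₂', W₃', hW₃', h₁₂, h₁₃, h₂₃, hY₁, hY₂, hY₃⟩ := h3 v hv
          have d₁₂ := hdisj v hv W₁' hW₁' W₂' hW₂' h₁₂
          have d₁₃ := hdisj v hv W₁' hW₁' W₃' hW₃' h₁₃
          have d₂₃ := hdisj v hv W₂' hW₂' W₃' hW₃' h₂₃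
          have gen : ∀ W₂ ∈ B v, (W₂ ∩ (Y : Set V)).Nonempty → W₂ ≠ W → u ∉ W₂ →
              ((X₀ \ W) ∩ (Y' : Set V)).Nonempty := by
            intro W₂ hW₂ hW₂Y hW₂W huW₂
            have hsub : W₂ ⊆ X₀ := hnest u huR v hv huv X₀ hX₀ hvU W₂ hW₂ huW₂
            have hdis : Disjoint W₂ W := hdisj v hv W₂ hW₂ W hW hW₂W
            obtain ⟨y, hyW₂, hyY⟩ := hW₂Y
            have hyW : y ∉ W := Set.disjoint_left.mp hdis hyW₂
            refine ⟨y, ⟨hsub hyW₂, hyW⟩, ?_⟩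
            rw [Finset.mem_coe, hY'def, Finset.mem_filter]
            exact ⟨hyY, hyW⟩
          rcases exists_ne_and_not_mem (W := W) (u := u) h₁₂ h₁₃ h₂₃ d₁₂ d₁₃ d₂₃ with
            ⟨hne, hnm⟩ | ⟨hne, hnm⟩ | ⟨hne, hnm⟩
          · exact gen W₁' hW₁' hY₁ hne hnm
          · exact gen W₂' hW₂' hY₂ hne hnm
          · exact gen W₃' hW₃' hY₃ hne hnm
        · obtain ⟨y, hyX₀, hyY⟩ := hX₀Y
          have hyW : y ∉ W := Set.disjoint_left.mp (hmiss X₀ hX₀ h0) hyX₀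
          refine ⟨y, ⟨hyX₀, hyW⟩, ?_⟩
          rw [Finset.mem_coe, hY'def, Finset.mem_filter]
          exact ⟨hyY, hyW⟩
      obtain ⟨W₁, hW₁, W₂, hW₂, W₃, hW₃, h₁₂, h₁₃, h₂₃, hY₁, hY₂, hY₃⟩ := h3 u huR
      refine ⟨W₁ \ W, ⟨W₁, hW₁, rfl⟩, W₂ \ W, ⟨W₂, hW₂, rfl⟩, W₃ \ W, ⟨W₃, hW₃, rfl⟩,
        fun e => h₁₂ (hinj W₁ hW₁ W₂ hW₂ e), fun e => h₁₃ (hinj W₁ hW₁ W₃ hW₃ e),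
        fun e => h₂₃ (hinj W₂ hW₂ W₃ hW₃ e),
        hmeet W₁ hW₁ hY₁, hmeet W₂ hW₂ hY₂, hmeet W₃ hW₃ hY₃⟩
    have ihR' := ih R'.card hR'card Vs' R' Y' B' rfl hR'ne hR' hY' hRY' hsubset' hdisj' hcover' hnest' h3'
    have hRcard : R.card = R'.card + 1 := by
      rw [hR'def, Finset.card_erase_of_mem hv]
      have : 1 ≤ R.card := Finset.card_pos.mpr ⟨v, hv⟩
      omega
    omega
  · -- base case: `R = {v}`; three disjoint branches at `v` meeting `Y` give `|Y| ≥ 3`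
    have hR1 : R = {v} := by
      rw [Finset.not_nonempty_iff_eq_empty] at hR'ne
      ext x
      constructor
      · intro hx
        by_contra hxv
        have : x ∈ R.erase v := Finset.mem_erase.mpr ⟨fun e => hxv (e ▸ Finset.mem_singleton_self _), hx⟩
        rw [← hR'def, hR'ne] at this
        simp at this
      · intro hx
        rw [Finset.mem_singleton] at hx
        exact hx ▸ hv
    obtain ⟨W₁, hW₁, W₂, hW₂, W₃, hW₃, h₁₂, h₁₃, h₂₃, hY₁, hY₂, hY₃⟩ := h3 v hv
    have d₁₂ := hdisj v hv W₁ hW₁ W₂ hW₂ h₁₂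
    have d₁₃ := hdisj v hv W₁ hW₁ W₃ hW₃ h₁₃
    have d₂₃ := hdisj v hv W₂ hW₂ W₃ hW₃ h₂₃
    obtain ⟨y₁, hy₁W, hy₁Y⟩ := hY₁
    obtain ⟨y₂, hy₂W, hy₂Y⟩ := hY₂
    obtain ⟨y₃, hy₃W, hy₃Y⟩ := hY₃
    have n₁₂ : y₁ ≠ y₂ := fun e => Set.disjoint_left.mp d₁₂ hy₁W (e ▸ hy₂W)
    have n₁₃ : y₁ ≠ y₃ := fun e => Set.disjoint_left.mp d₁₃ hy₁W (e ▸ hy₃W)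
    have n₂₃ : y₂ ≠ y₃ := fun e => Set.disjoint_left.mp d₂₃ hy₂W (e ▸ hy₃W)
    have hsub : ({y₁, y₂, y₃} : Finset V) ⊆ Y := by
      intro x hx
      simp only [Finset.mem_insert, Finset.mem_singleton] at hx
      rcases hx with rfl | rfl | rfl
      · exact Finset.mem_coe.mp hy₁Y
      · exact Finset.mem_coe.mp hy₂Y
      · exact Finset.mem_coe.mp hy₃Y
    have h3card : ({y₁, y₂, y₃} : Finset V).card = 3 :=
      Finset.card_eq_three.mpr ⟨y₁, y₂, y₃, n₁₂, n₁₃, n₂₃, rfl⟩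
    have := Finset.card_le_card hsub
    rw [hR1, Finset.card_singleton]
    omega


/-- Reachability avoiding `v` is symmetric. -/
theorem reach_avoid_symm (K : SimpleGraph V) {v a b : V}
    (h : ∃ p : K.Walk a b, v ∉ p.support) : ∃ p : K.Walk b a, v ∉ p.support :=
  let ⟨p, hp⟩ := h
  ⟨p.reverse, by rwa [SimpleGraph.Walk.support_reverse, List.mem_reverse]⟩

/-- Reachability avoiding `v` is transitive. -/
theorem reach_avoid_trans (K : SimpleGraph V) {v a b c : V}
    (h₁ : ∃ p : K.Walk a b, v ∉ p.support) (h₂ : ∃ p : K.Walk b c, v ∉ p.support) :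
    ∃ p : K.Walk a c, v ∉ p.support := by
  obtain ⟨p, hp⟩ := h₁
  obtain ⟨q, hq⟩ := h₂
  refine ⟨p.append q, ?_⟩
  rw [SimpleGraph.Walk.support_append, List.mem_append]
  rintro (h | h); exacts [hp h, hq (List.mem_of_mem_tail h)]

/-- The endpoints of a walk avoiding `v` differ from `v`. -/
theorem reach_avoid_ne (K : SimpleGraph V) {v a b : V}
    (h : ∃ p : K.Walk a b, v ∉ p.support) : a ≠ v ∧ b ≠ v :=
  let ⟨p, hp⟩ := h
  ⟨fun e => hp (e ▸ p.start_mem_support), fun e => hp (e ▸ p.end_mem_support)⟩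

/-- Every vertex on a walk avoiding `v` is reachable from its start avoiding `v`. -/
theorem reach_avoid_of_mem_support (K : SimpleGraph V) {v a b z : V} (p : K.Walk a b)
    (hp : v ∉ p.support) (hz : z ∈ p.support) : ∃ q : K.Walk a z, v ∉ q.support := by
  classical exact
    ⟨p.takeUntil z hz, fun h => hp (SimpleGraph.Walk.support_takeUntil_subset_support p hz h)⟩

/-- Nesting, graph form (`W''` = class of `a''` in `K − v'`, `v ∉ W''`; walk `u → x ∈ W''`). -/
theorem reach_avoid_nest (K : SimpleGraph V) {v v' a'' : V} (hvv' : v ≠ v')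
    (hvW : ¬ ∃ p : K.Walk a'' v, v' ∉ p.support) :
    ∀ {u x : V}, K.Walk u x → (∃ p : K.Walk a'' x, v' ∉ p.support) →
      (∃ p : K.Walk a'' u, v' ∉ p.support) ∨ (∃ p : K.Walk v' x, v ∉ p.support) := by
  intro u x q
  induction q with
  | nil => intro hx; exact Or.inl hx
  | @cons u y x h q' ih =>
    intro hx
    rcases ih hx with hy | hvx
    · have hy_ne : y ≠ v' := (reach_avoid_ne K hy).2
      by_cases huv' : u = v'
      · subst huv'
        obtain ⟨p₀, hp₀⟩ := reach_avoid_trans K (reach_avoid_symm K hy) hx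
        have hp₀v : v ∉ p₀.support := fun hv =>
          hvW (reach_avoid_trans K hy (reach_avoid_of_mem_support K p₀ hp₀ hv))
        refine Or.inr ⟨SimpleGraph.Walk.cons h p₀, ?_⟩
        rw [SimpleGraph.Walk.support_cons, List.mem_cons]
        rintro (e | e); exacts [hvv' e, hp₀v e]
      · have huy : ∃ p : K.Walk y u, v' ∉ p.support := by
          refine ⟨SimpleGraph.Walk.cons (K.adj_symm h) SimpleGraph.Walk.nil, ?_⟩
          rw [SimpleGraph.Walk.support_cons, SimpleGraph.Walk.support_nil, List.mem_cons,
            List.mem_singleton]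
          rintro (e | e); exacts [hy_ne e.symm, huv' e.symm]
        exact Or.inl (reach_avoid_trans K hy huy)
    · exact Or.inr hvx

/-- UNIQUENESS-p6-v1 Lemma 3.5 for graphs: `K` connected, `R ∩ Y = ∅`, `R ≠ ∅`, every `v ∈ R` has
three vertices of `Y` pairwise not joined by a walk avoiding `v`; then `|R| + 2 ≤ |Y|`. -/
theorem card_add_two_le_of_connected (K : SimpleGraph V) (hK : K.Connected) (R Y : Finset V)
    (hne : R.Nonempty) (hRY : Disjoint R Y)
    (h3 : ∀ v ∈ R, ∃ y₁ ∈ Y, ∃ y₂ ∈ Y, ∃ y₃ ∈ Y,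
      (¬ ∃ p : K.Walk y₁ y₂, v ∉ p.support) ∧ (¬ ∃ p : K.Walk y₁ y₃, v ∉ p.support) ∧
      (¬ ∃ p : K.Walk y₂ y₃, v ∉ p.support)) :
    R.card + 2 ≤ Y.card := by
  classical
  let B : V → Set (Set V) := fun v =>
    {S | ∃ a, a ≠ v ∧ S = {b | ∃ p : K.Walk a b, v ∉ p.support}}
  have class_eq : ∀ {v a a' : V}, (∃ p : K.Walk a a', v ∉ p.support) →
      {b | ∃ p : K.Walk a b, v ∉ p.support} = {b | ∃ p : K.Walk a' b, v ∉ p.support} := by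
    intro v a a' haa'
    exact Set.ext fun b => ⟨fun hb => reach_avoid_trans K (reach_avoid_symm K haa') hb,
      fun hb => reach_avoid_trans K haa' hb⟩
  have hRv : ∀ v ∈ R, ∀ y ∈ Y, y ≠ v := fun v hv y hy e => Finset.disjoint_left.mp hRY hv (e ▸ hy)
  have self : ∀ {v} (y : V), y ≠ v → ∃ p : K.Walk y y, v ∉ p.support := fun y hy =>
    ⟨SimpleGraph.Walk.nil, by rw [SimpleGraph.Walk.support_nil, List.mem_singleton]; exact fun e => hy e.symm⟩
  refine card_add_two_le R.card Set.univ R Y B rfl hne (Set.subset_univ _) (Set.subset_univ _)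
    hRY ?_ ?_ ?_ ?_ ?_
  · rintro v _ W ⟨a, _, rfl⟩ b hb
    exact ⟨Set.mem_univ _, (reach_avoid_ne K hb).2⟩
  · intro v _ W hW W' hW' hWW'
    obtain ⟨a, _, rfl⟩ := hW
    obtain ⟨a', _, rfl⟩ := hW'
    rw [Set.disjoint_left]
    exact fun b hb hb' => hWW' (class_eq (reach_avoid_trans K hb (reach_avoid_symm K hb')))
  · intro v _ u hu
    have huv : u ≠ v := fun e => hu.2 (Set.mem_singleton_iff.mpr e); exact ⟨_, ⟨u, huv, rfl⟩, self u huv⟩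
  · intro v _ v' _ hvv' W' hW' hv'W' W'' hW'' hvW''
    obtain ⟨a', _, rfl⟩ := hW'
    obtain ⟨a'', _, rfl⟩ := hW''
    intro b hb
    obtain ⟨q⟩ := hK.preconnected v' b
    rcases reach_avoid_nest K hvv' hvW'' q hb with hv'W'' | hb'
    · exact absurd (reach_avoid_ne K hv'W'').2 (fun e => e rfl)
    · exact reach_avoid_trans K hv'W' hb'
  · intro v hv
    obtain ⟨y₁, hy₁, y₂, hy₂, y₃, hy₃, n₁₂, n₁₃, n₂₃⟩ := h3 v hv
    have hne₁ := hRv v hv y₁ hy₁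
    have hne₂ := hRv v hv y₂ hy₂
    have hne₃ := hRv v hv y₃ hy₃
    have distinct : ∀ {y y' : V}, y' ≠ v → (¬ ∃ p : K.Walk y y', v ∉ p.support) →
        {b | ∃ p : K.Walk y b, v ∉ p.support} ≠ {b | ∃ p : K.Walk y' b, v ∉ p.support} := by
      intro y y' hy' hn e
      have : y' ∈ {b | ∃ p : K.Walk y b, v ∉ p.support} := by rw [e]; exact self y' hy'
      exact hn this
    exact ⟨_, ⟨y₁, hne₁, rfl⟩, _, ⟨y₂, hne₂, rfl⟩, _, ⟨y₃, hne₃, rfl⟩, distinct hne₂ n₁₂,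
      distinct hne₃ n₁₃, distinct hne₃ n₂₃,
      ⟨y₁, self y₁ hne₁, hy₁⟩, ⟨y₂, self y₂ hne₂, hy₂⟩, ⟨y₃, self y₃ hne₃, hy₃⟩⟩

end Summit.Ventures.PercRepro0.BranchCount
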